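import Summits.RiemannHypothesis.RiemannHypothesis.Theorems.WeilGroundStateGroundStatesConvergeToXiStubWeakL2Compact
import Summits.RiemannHypothesis.RiemannHypothesis.Theorems.WeilGroundStateGroundStatesConvergeToXiWeakLimitMellin
import Literature.NumberTheory.LFunctions.WeilExplicit
import Literature.NumberTheory.LFunctions.WeilGroundState
import Literature.NumberTheory.LFunctions.WeilGroundStateRealZerosProofs
import HarnessLib

/-!
# `WeilGroundState.GroundStatesConvergeToXi` — EXISTENCE of weak limits and the RH-free
TRICHOTOMY for renormalised ground states with bounded constants
(crux item stmt-RiemannHypothesis-1527, route route-RiemannHypothesis-WeilGroundState; line `Sketch`,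
lead file of rev L11c, continuation lead c9; `--supports`)

Let `u_k` be operator-free Weil ground states at windows `a_k → ∞` (`‖u_k‖₂ = 1`) and `c_k`
BOUNDED scalars (`‖c_k‖ ≤ K`) such that `c_k u_k` is bounded in ONE weighted `L¹(e^{b₀|t|})`,
`b₀ > 1/2`.  Then weak limits EXIST (C1, weak sequential compactness of bounded sets of `L²(ℝ)`),
and the landed dichotomy (rev L11) classifies them, giving — with no "let `v` be a weak limit"
hypothesis left —

* `stub_weak_trichotomy` / `weak_trichotomy` (RH-free): EITHER `c_k u_k ⇀ 0` weakly against
  every test function (TOTAL ESCAPE), OR the Riemann hypothesis holds and some subsequence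
  converges weakly to a NON-ZERO `L²` function `v` which is Weil-harmonic (`W(v ⋆ g̃) = 0` for
  all tests `g`) and Mellin-pinned (`v̂(ρ) = 0` at every non-trivial zero).
* `weakly_null_of_not_riemannHypothesis` (ESCAPE): under `¬RH` every such sequence is weakly
  null — the position-space form of "the ground state's mass escapes to the window edges".
* `exists_subseq_weakLimit_groundStates`: the compactness step alone.

Bearing on the crux: with bounded constants the weak-limit programme is now unconditional in
existence; the RH-content is exactly "not total escape" (NV), after which IDENT (`v = c·Φ`) is the
residual (CCM25 §8 step 2; not visible to the explicit formula, `exists_weilHarmonic_not_const_mul_phi`).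

Mathlib + proved tree files (C1 `stub_weakL2_compact`, rev L11/L11b lead files); no named fact;
no definitions.
-/

noncomputable section

set_option linter.dupNamespace false

open scoped Topology Real ComplexConjugate
open Filter Set MeasureTheory Complex

namespace Summit.RiemannHypothesis.RiemannHypothesis.Theorems.GroundStatesConvergeToXi

open Literature.NumberTheory.LFunctions

/-- **Weak limits of renormalised ground states with bounded constants exist** (along a
subsequence, as `L²` functions, against every `L²` test): `‖c_k u_k‖₂ = ‖c_k‖ ≤ K`. [folklore] -/
theorem exists_subseq_weakLimit_groundStates {a : ℕ → ℝ} {u : ℕ → ℝ → ℂ} {c : ℕ → ℂ} {K : ℝ}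
    (hu : ∀ k, IsWeilGroundState (a k) (u k)) (hK : ∀ k, ‖c k‖ ≤ K) :
    ∃ φ : ℕ → ℕ, StrictMono φ ∧ ∃ v : ℝ → ℂ, MemLp v 2 volume ∧
      ∀ g : ℝ → ℂ, MemLp g 2 volume →
        Tendsto (fun k => ∫ t, c (φ k) * u (φ k) t * g t) atTop (𝓝 (∫ t, v t * g t)) := by
  have hf : ∀ k, MemLp (fun t => c k * u k t) 2 volume := fun k => (hu k).memLp.const_mul (c k)
  have hB : ∀ k, ∫ t, ‖c k * u k t‖ ^ 2 ≤ K ^ 2 := by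
    intro k
    have h1 : ∫ t, ‖c k * u k t‖ ^ 2 = ‖c k‖ ^ 2 * ∫ t, ‖u k t‖ ^ 2 := by
      rw [← integral_const_mul]
      refine integral_congr_ae (ae_of_all _ fun t => ?_)
      simp only [norm_mul, mul_pow]
    rw [h1, (hu k).integral_norm_sq, mul_one]
    exact pow_le_pow_left₀ (norm_nonneg _) (hK k) 2
  exact stub_weakL2_compact (fun k t => c k * u k t) (K ^ 2) hf hB

/-- **Stub C2 — `weak_trichotomy` (registered LEAD assembly stub of rev L11c; RH-free).**
Ground states `u_k` at windows `a_k → ∞`, scalars `c_k` with `‖c_k‖ ≤ K` and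
`∫ ‖c_k u_k‖ e^{b₀|t|} ≤ M` for ONE `b₀ > 1/2`: EITHER `c_k u_k ⇀ 0` against every Weil test
function, OR RH holds and a subsequence converges weakly (against tests) to a non-zero `L²`
function `v` that is Weil-harmonic and Mellin-pinned at every non-trivial zero. [folklore] -/
theorem stub_weak_trichotomy :
    ∀ (a : ℕ → ℝ) (u : ℕ → ℝ → ℂ) (c : ℕ → ℂ) (b₀ M K : ℝ),
      Tendsto a atTop atTop → (∀ k, IsWeilGroundState (a k) (u k)) → 1 / 2 < b₀ →
      (∀ k, ∫ t, ‖c k * u k t‖ * Real.exp (b₀ * |t|) ≤ M) → (∀ k, ‖c k‖ ≤ K) →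
      (∀ g : ℝ → ℂ, IsWeilTest g → Tendsto (fun k => ∫ t, c k * u k t * g t) atTop (𝓝 0)) ∨
      (RiemannHypothesis ∧ ∃ φ : ℕ → ℕ, StrictMono φ ∧ ∃ v : ℝ → ℂ, MemLp v 2 volume ∧
        ¬ (v =ᵐ[volume] 0) ∧
        (∀ g : ℝ → ℂ, IsWeilTest g →
          Tendsto (fun k => ∫ t, c (φ k) * u (φ k) t * g t) atTop (𝓝 (∫ t, v t * g t))) ∧
        (∀ g : ℝ → ℂ, IsWeilTest g → weilFunctional (weilConv v (weilReflect g)) = 0) ∧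
        ∀ ρ : ℂ, ρ ∈ ZetaZeros.riemannZetaNontrivialZeros → weilMellin v ρ = 0) := by
  intro a u c b₀ M K ha hu hb₀ hM hK
  by_cases hnull : ∀ g : ℝ → ℂ, IsWeilTest g →
      Tendsto (fun k => ∫ t, c k * u k t * g t) atTop (𝓝 0)
  · exact Or.inl hnull
  right
  push Not at hnull
  obtain ⟨g₀, hg₀, hnt⟩ := hnull
  -- a subsequence along which the pairings with `g₀` stay `≥ ε`
  obtain ⟨ε, hε, hfreq⟩ : ∃ ε : ℝ, 0 < ε ∧ ∃ᶠ k in atTop, ε ≤ ‖∫ t, c k * u k t * g₀ t‖ := by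
    by_contra hcon
    push Not at hcon
    apply hnt
    rw [tendsto_zero_iff_norm_tendsto_zero]
    refine Metric.tendsto_nhds.2 fun ε hε => ?_
    filter_upwards [hcon ε hε] with k hk
    rwa [Real.dist_eq, sub_zero, abs_of_nonneg (norm_nonneg _)]
  obtain ⟨ψ, hψ, hψε⟩ := extraction_of_frequently_atTop hfreq
  -- weak compactness along `ψ`
  obtain ⟨φ, hφ, v, hv, hlim⟩ :=
    exists_subseq_weakLimit_groundStates (a := a ∘ ψ) (u := fun k => u (ψ k)) (c := fun k => c (ψ k))
      (fun k => hu (ψ k)) (fun k => hK (ψ k))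
  set θ : ℕ → ℕ := ψ ∘ φ with hθdef
  have hθ : StrictMono θ := hψ.comp hφ
  have haθ : Tendsto (a ∘ θ) atTop atTop := ha.comp hθ.tendsto_atTop
  have hweak : ∀ g : ℝ → ℂ, IsWeilTest g →
      Tendsto (fun k => ∫ t, c (θ k) * u (θ k) t * g t) atTop (𝓝 (∫ t, v t * g t)) :=
    fun g hg => hlim g (ConnesVanSuijlekom.isWeilTest_memLp hg)
  -- the limit pairs non-trivially with `g₀`
  have hne : ∫ t, v t * g₀ t ≠ 0 := by
    intro h0
    have h1 := (hweak g₀ hg₀).norm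
    rw [h0, norm_zero] at h1
    have h2 : ∀ k, ε ≤ ‖∫ t, c (θ k) * u (θ k) t * g₀ t‖ := fun k => hψε (φ k)
    have := ge_of_tendsto' h1 h2
    linarith
  have hv0 : ¬ (v =ᵐ[volume] 0) := by
    intro hv0
    apply hne
    refine integral_eq_zero_of_ae ?_
    filter_upwards [hv0] with t ht
    simp [ht]
  -- RH (c0) and the dichotomy of rev L11 along `θ`
  have hRH : RiemannHypothesis := riemannHypothesis_of_tight_weakLimit_ne_zero
    ⟨a ∘ θ, fun k => u (θ k), fun k => c (θ k), haθ, fun k => hu (θ k),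
      ⟨b₀, hb₀, M, fun k => hM (θ k)⟩, fun g => ∫ t, v t * g t, hweak, g₀, hg₀, hne⟩
  obtain ⟨-, hharm, hzero⟩ := weakLimit_harmonic_of_locallyIntegrable (a := a ∘ θ)
    (u := fun k => u (θ k)) (c := fun k => c (θ k)) haθ (fun k => hu (θ k)) hb₀
    (fun k => hM (θ k)) (hv.locallyIntegrable (by norm_num)) hweak
  exact ⟨hRH, θ, hθ, v, hv, hv0, hweak, hharm, hzero⟩

/-- **RH-free trichotomy, curried form.** [folklore] -/
theorem weak_trichotomy {a : ℕ → ℝ} {u : ℕ → ℝ → ℂ} {c : ℕ → ℂ} {b₀ M K : ℝ}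
    (ha : Tendsto a atTop atTop) (hu : ∀ k, IsWeilGroundState (a k) (u k)) (hb₀ : 1 / 2 < b₀)
    (hM : ∀ k, ∫ t, ‖c k * u k t‖ * Real.exp (b₀ * |t|) ≤ M) (hK : ∀ k, ‖c k‖ ≤ K) :
    (∀ g : ℝ → ℂ, IsWeilTest g → Tendsto (fun k => ∫ t, c k * u k t * g t) atTop (𝓝 0)) ∨
      (RiemannHypothesis ∧ ∃ φ : ℕ → ℕ, StrictMono φ ∧ ∃ v : ℝ → ℂ, MemLp v 2 volume ∧
        ¬ (v =ᵐ[volume] 0) ∧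
        (∀ g : ℝ → ℂ, IsWeilTest g →
          Tendsto (fun k => ∫ t, c (φ k) * u (φ k) t * g t) atTop (𝓝 (∫ t, v t * g t))) ∧
        (∀ g : ℝ → ℂ, IsWeilTest g → weilFunctional (weilConv v (weilReflect g)) = 0) ∧
        ∀ ρ : ℂ, ρ ∈ ZetaZeros.riemannZetaNontrivialZeros → weilMellin v ρ = 0) :=
  stub_weak_trichotomy a u c b₀ M K ha hu hb₀ hM hK

/-- **ESCAPE: under `¬RH` every bounded, `b₀ > 1/2`-tight renormalisation of ground states on
windows `a_k → ∞` is weakly null** — no "let `v` be a weak limit" hypothesis. [folklore] -/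
theorem weakly_null_of_not_riemannHypothesis (hRH : ¬ RiemannHypothesis) {a : ℕ → ℝ}
    {u : ℕ → ℝ → ℂ} {c : ℕ → ℂ} {b₀ M K : ℝ} (ha : Tendsto a atTop atTop)
    (hu : ∀ k, IsWeilGroundState (a k) (u k)) (hb₀ : 1 / 2 < b₀)
    (hM : ∀ k, ∫ t, ‖c k * u k t‖ * Real.exp (b₀ * |t|) ≤ M) (hK : ∀ k, ‖c k‖ ≤ K)
    {g : ℝ → ℂ} (hg : IsWeilTest g) :
    Tendsto (fun k => ∫ t, c k * u k t * g t) atTop (𝓝 0) := by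
  rcases weak_trichotomy ha hu hb₀ hM hK with h | ⟨h, -⟩
  · exact h g hg
  · exact absurd h hRH

/-- **Hurwitz refinement** (conditional on `GroundStateSimpleEven`): in the second alternative
of the trichotomy the non-zero limit has `v̂` zero-free on the right open half-strip. [folklore] -/
theorem weak_trichotomy_hurwitz
    (h₁ : Summit.RiemannHypothesis.RiemannHypothesis.Theses.WeilGroundState.GroundStateSimpleEven)
    {a : ℕ → ℝ} {u : ℕ → ℝ → ℂ} {c : ℕ → ℂ} {b₀ M K : ℝ}
    (ha : Tendsto a atTop atTop) (hu : ∀ k, IsWeilGroundState (a k) (u k)) (hb₀ : 1 / 2 < b₀)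
    (hM : ∀ k, ∫ t, ‖c k * u k t‖ * Real.exp (b₀ * |t|) ≤ M) (hK : ∀ k, ‖c k‖ ≤ K) :
    (∀ g : ℝ → ℂ, IsWeilTest g → Tendsto (fun k => ∫ t, c k * u k t * g t) atTop (𝓝 0)) ∨
      (RiemannHypothesis ∧ ∃ φ : ℕ → ℕ, StrictMono φ ∧ ∃ v : ℝ → ℂ, MemLp v 2 volume ∧
        ¬ (v =ᵐ[volume] 0) ∧
        (∀ g : ℝ → ℂ, IsWeilTest g →
          Tendsto (fun k => ∫ t, c (φ k) * u (φ k) t * g t) atTop (𝓝 (∫ t, v t * g t))) ∧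
        (∀ g : ℝ → ℂ, IsWeilTest g → weilFunctional (weilConv v (weilReflect g)) = 0) ∧
        (∀ ρ : ℂ, ρ ∈ ZetaZeros.riemannZetaNontrivialZeros → weilMellin v ρ = 0) ∧
        ∀ s : ℂ, 1 / 2 < s.re → s.re < 1 → weilMellin v s ≠ 0) := by
  rcases weak_trichotomy ha hu hb₀ hM hK with h | ⟨hRH, φ, hφ, v, hv, hv0, hweak, hharm, hzero⟩
  · exact Or.inl h
  · refine Or.inr ⟨hRH, φ, hφ, v, hv, hv0, hweak, hharm, hzero, ?_⟩
    rcases weakLimit_hurwitz h₁ (ha.comp hφ.tendsto_atTop) (fun k => hu (φ k)) hb₀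
      (fun k => hM (φ k)) (hv.locallyIntegrable (by norm_num)) hweak with h0 | hzf
    · exact absurd h0 hv0
    · exact hzf

end Summit.RiemannHypothesis.RiemannHypothesis.Theorems.GroundStatesConvergeToXi

end
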